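/- Copyright: the b2b-balaban cell (near-miss cell 7), T⁴-continuum fan-out, lineage t4-ne7b-p1 (row NE7b OWNER + CRUX
PROVER NE7b), gen 46: (α)-M5-4b «THE FIBRE CHARGE» — the charge with the fibre share booked, on the tagged genealogy
(ruling R-OWNER-46-1 as amended by W-ne7bp1-g46-3 after F-ne7bleaf02g28-2).  Released under the licence of the
surrounding project. -/
import Summits.QuantumFields.BalabanUV.T4Continuum.Support.HistoryBankingFibreRoom

/-!
# M5-4b: THE FIBRE CHARGE — print's booked credits + the count's discount + the member's FIBRE SHARE are together below the
sharp exponents, on the TAGGED genealogy (re-open object (α) of row NE7b, `SCOPE-alpha.md` §5 row M5; ruling R-OWNER-46-1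
«M5-4 THE FIBRE READING» as amended by the owner's word W-ne7bp1-g46-3 adopting leaf-02-g28's located typing point
F-ne7bleaf02g28-2; owner gen 46)

Summits-side support leaf of the T⁴-continuum cell (rung (B)+1 on a FINITE torus only; NOT infinite volume, NOT the
mass gap, NOT the Clay statement; NOT a proof of the spine estimate NE7b — the cell's OWN estimate, NOT PRINTED, NOT
PROVED).  [folklore] real arithmetic over `HistoryBankingFibreRoom` (`RoundingRoomF`, `RoundingRoomF.toRoundingRoom`) and
gen 45's `HistoryBankingDiscountCharge` (`sharpT`, `credits_add_discount_le_sharps`); no definition, no `[cite:]` tag,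
nothing printed asserted, no `Prop` fact of Bałaban's minted, zero `sorry`.

WHY.  F-ne7bleaf02g28-2 (journal l.31620): the LIVE product's third factor `evProd (fB K) (fR K) (pedMV.toPGen id (K, x))`
is NOT key-readable (the birth letters `fB K j d′ n` carry the region `n`); the key-level live price is read one step up
the chain, at the SHARP letters — `LIVE♯(G) = e^{lifeCost … G}·e^{birthWT sh (uV K) G}·e^{−credits (sharpT (sB K) (sR K) ∘ sh) G}`
(`LIVE_true ≤ LIVE♯` member by member is gen 45's `evProd_le_exp_neg_sharps`) — and the fibre factor is
`MULT(G) = e^{+credits (sharpT (φB K) (φR K) ∘ sh) G}` (the per-event fibre share IS a `sharpT` table).  Then the END's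
`priceM` at `FcM := LIVE♯`, `RfM := MULT` is, member by member, the CHARGE
`credits (pcredit ∘ sh) G + Ξ G + credits (sharpT φB φR ∘ sh) G ≤ credits (sharpT sB sR ∘ sh) G` — gen 45's charge with
the fibre share BOOKED, i.e. exactly `RoundingRoomF`'s content on the tagged genealogy; no `PGen`, no letter inflation
needed (the sibling's §3–§4 inflation road stays the equivalent `LIVE_true` form).

WHAT.  `sharpT_sub` (the sharp-exponent letter is linear in its tables), `credits_sharpT_sub`,
**`credits_add_discount_add_fshare_le_sharps`** (THE CHARGE WITH THE FIBRE SHARE, tagged form, under `RoundingRoomF` + (2.9)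
+ `L ≥ 1` + `E₂ > 0` + `E₃ ≥ 0`, for `ConsistentTLE`, well-formed `G`), **`exp_neg_sharps_mul_exp_fshare_le`** (factor form:
`e^{−credits σ}·e^{+credits φ} ≤ e^{−credits pcredit}·e^{−Ξ}`) — the per-member hypothesis of the crew's key-level
`priceM_of_keys_of_charge` (leaf-02 Module B′ `HistoryPriceKeys`, IR-46-1 (A)).

HONEST SCOPE.  Bookkeeping; `RoundingRoomF` is a HYPOTHESIS SHAPE (located display), nothing of Bałaban's asserted or
contested.  BY-NAME EFFECT ON THE WALL: none by itself (it is the owner's half of `priceM` at `FcM := LIVE♯`; the crew's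
key readings + plug complete it).  NE7b NOT proved; spine 0∕9.  HONEST DEPENDENCY (cell): continuum YM on T⁴ ⇐ BetaPertH ∧
nine spine estimates (0/9 proved); BetaPertH ⇐ (D1) ∧ (D4) ∧ CAP+tail; G-an2-4 gates asym, D1 and NE2/3/4.  This file
changes none of it.
-/

open Finset
open Literature.MathematicalPhysics.QuantumFieldTheory.Balaban1983to89
open T4PersistenceDictionary T4PrintedShapeBanking T4TaggedShapeBanking T4BankedInduction T4PartnerMultiplicity
open T4BranchingRecordsGas
open Summit.QuantumFields.BalabanUV.T4Continuum.HistoryBankingLE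
open Summit.QuantumFields.BalabanUV.T4Continuum.HistoryConstants
open Summit.QuantumFields.BalabanUV.T4Continuum.HistoryBankingDiscountCharge
open Summit.QuantumFields.BalabanUV.T4Continuum.HistoryBankingFibreRoom

namespace Summit.QuantumFields.BalabanUV.T4Continuum.HistoryBankingFibreCharge

noncomputable section

section ChargeF

variable {ε : Type*} [DecidableEq ε] {sh : ε → PEv} {C : T4PrintedShapeBanking.Consts} {O : PrintedO1s} {L K : ℕ}
  {R : ℕ → ℕ} {g : ℕ → ℝ} {β' β₀ : ℝ} {sB : ℕ → ℕ → ℝ} {sR : ℕ → ℝ} {φB : ℕ → ℕ → ℝ} {φR : ℕ → ℝ}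

/-- **THE SHARP-EXPONENT LETTER IS LINEAR IN ITS TABLES**: at the reduced sharps `sB − φB`, `sR − φR` it reads
`sharpT sB sR e − sharpT φB φR e` (births, renewals; mergers `0 − 0`). [folklore] -/
theorem sharpT_sub (sB φB : ℕ → ℕ → ℝ) (sR φR : ℕ → ℝ) (e : PEv) :
    sharpT (fun j d => sB j d - φB j d) (fun h => sR h - φR h) e = sharpT sB sR e - sharpT φB φR e := by
  unfold sharpT
  split_ifs <;> simp

/-- the credits of the reduced sharp letters are the sharp credits minus the FIBRE-SHARE credits [folklore] -/
theorem credits_sharpT_sub (sB φB : ℕ → ℕ → ℝ) (sR φR : ℕ → ℝ) (G : Gen ε) :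
    credits (sharpT (fun j d => sB j d - φB j d) (fun h => sR h - φR h) ∘ sh) G =
      credits (sharpT sB sR ∘ sh) G - credits (sharpT φB φR ∘ sh) G := by
  simp only [credits, Function.comp_apply, sharpT_sub, Finset.sum_sub_distrib]

/-- **THE CHARGE WITH THE FIBRE SHARE BOOKED (tagged form)**: under `RoundingRoomF`, (2.9) on the run, `L ≥ 1`, `E₂ > 0`,
`E₃ ≥ 0`, for every `ConsistentTLE`, well-formed tagged genealogy `G`:
`credits (pcredit O C g ∘ sh) G + (8∕E₂·totalCostT sh C K R G + 4·partnerAges (PEv.step ∘ sh) G) + credits (sharpT φB φR ∘ sh) G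
  ≤ credits (sharpT sB sR ∘ sh) G` — print's booked credits + the count's discount + the member's FIBRE SHARE are together
below the sharp exponents (gen 45's `credits_add_discount_le_sharps` at the reduced sharps + `credits_sharpT_sub`).  This is,
member by member, the charge hypothesis of the key-level price sentence at `FcM := LIVE♯ = e^{lifeCost}·e^{birthWT u}·e^{−credits σ}`,
`RfM := MULT = ∏ e^{+credits φ}` (`σ = sharpT sB sR`, `φ = sharpT φB φR`). [folklore] -/
theorem credits_add_discount_add_fshare_le_sharps (h29 : B14FlowStep.FlowIneq29 R g L β' β₀ K) (hL : 1 ≤ L)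
    (hE₂ : 0 < C.E₂) (hE₃ : 0 ≤ C.E₃) (hRR : RoundingRoomF C O L K R g sB sR φB φR) {G : Gen ε}
    (hW : G.WF (dictWT sh R C.n₁)) (hc : ConsistentTLE sh C K R G) :
    credits (pcredit O C g ∘ sh) G +
          (8 / C.E₂ * totalCostT sh C K R G + 4 * (partnerAges (PEv.step ∘ sh) G : ℝ)) +
        credits (sharpT φB φR ∘ sh) G ≤
      credits (sharpT sB sR ∘ sh) G := by
  have h := credits_add_discount_le_sharps h29 hL hE₂ hE₃ hRR.toRoundingRoom hW hc
  have hs : (∑ e ∈ G.events, sharpT (fun j d => sB j d - φB j d) (fun h => sR h - φR h) (sh e)) =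
      credits (sharpT sB sR ∘ sh) G - credits (sharpT φB φR ∘ sh) G := by
    rw [← credits_sharpT_sub]
    rfl
  rw [hs] at h
  linarith

/-- **… IN FACTOR FORM** (the `priceM` inequality per member at `FcM := LIVE♯`, `RfM := MULT`, credit part):
`exp (−credits (sharpT sB sR ∘ sh) G) · exp (credits (sharpT φB φR ∘ sh) G)
  ≤ exp (−credits (pcredit O C g ∘ sh) G) · exp (−(8∕E₂·totalCostT sh C K R G + 4·partnerAges (PEv.step ∘ sh) G))`. [folklore] -/
theorem exp_neg_sharps_mul_exp_fshare_le (h29 : B14FlowStep.FlowIneq29 R g L β' β₀ K) (hL : 1 ≤ L)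
    (hE₂ : 0 < C.E₂) (hE₃ : 0 ≤ C.E₃) (hRR : RoundingRoomF C O L K R g sB sR φB φR) {G : Gen ε}
    (hW : G.WF (dictWT sh R C.n₁)) (hc : ConsistentTLE sh C K R G) :
    Real.exp (-credits (sharpT sB sR ∘ sh) G) * Real.exp (credits (sharpT φB φR ∘ sh) G) ≤
      Real.exp (-credits (pcredit O C g ∘ sh) G) *
        Real.exp (-(8 / C.E₂ * totalCostT sh C K R G + 4 * (partnerAges (PEv.step ∘ sh) G : ℝ))) := by
  rw [← Real.exp_add, ← Real.exp_add]
  exact Real.exp_le_exp.2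
    (by linarith [credits_add_discount_add_fshare_le_sharps h29 hL hE₂ hE₃ hRR hW hc])

/-- **THE `priceM` FACTOR INEQUALITY PER MEMBER AT `FcM := LIVE♯`, `RfM := MULT`** (all three factors): for any life-cost
exponent `ℓc` and class-remainder exponent `b` (the same on both sides),
`(e^{ℓc}·e^{b}·e^{−credits σ G}) · e^{credits φ G} ≤ (e^{−credits pcredit G}·e^{ℓc}) · e^{b} · e^{−Ξ G}` — the right-hand
side is `pshapeTH sh O C 1 1 R g 0 κ G · e^{b} · e^{−Ξ}` once `e^{−credits pcredit}·e^{ℓc}` is folded by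
`HistoryBankingCreditPlug.pshapeTH_one_one_zero` (`ℓc = lifeCost (dictWT sh R C.n₁) κ G`). [folklore] -/
theorem liveSharp_mul_mult_le (h29 : B14FlowStep.FlowIneq29 R g L β' β₀ K) (hL : 1 ≤ L)
    (hE₂ : 0 < C.E₂) (hE₃ : 0 ≤ C.E₃) (hRR : RoundingRoomF C O L K R g sB sR φB φR) {G : Gen ε}
    (hW : G.WF (dictWT sh R C.n₁)) (hc : ConsistentTLE sh C K R G) (ℓc b : ℝ) :
    Real.exp ℓc * Real.exp b * Real.exp (-credits (sharpT sB sR ∘ sh) G) *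
        Real.exp (credits (sharpT φB φR ∘ sh) G) ≤
      Real.exp (-credits (pcredit O C g ∘ sh) G) * Real.exp ℓc * Real.exp b *
        Real.exp (-(8 / C.E₂ * totalCostT sh C K R G + 4 * (partnerAges (PEv.step ∘ sh) G : ℝ))) := by
  have h := exp_neg_sharps_mul_exp_fshare_le h29 hL hE₂ hE₃ hRR hW hc (O := O) (sh := sh) (G := G)
  have h0 : 0 ≤ Real.exp ℓc * Real.exp b := mul_nonneg (Real.exp_pos _).le (Real.exp_pos _).le
  calc Real.exp ℓc * Real.exp b * Real.exp (-credits (sharpT sB sR ∘ sh) G) *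
        Real.exp (credits (sharpT φB φR ∘ sh) G)
      = Real.exp ℓc * Real.exp b * (Real.exp (-credits (sharpT sB sR ∘ sh) G) *
          Real.exp (credits (sharpT φB φR ∘ sh) G)) := by ring
    _ ≤ Real.exp ℓc * Real.exp b * (Real.exp (-credits (pcredit O C g ∘ sh) G) *
          Real.exp (-(8 / C.E₂ * totalCostT sh C K R G + 4 * (partnerAges (PEv.step ∘ sh) G : ℝ)))) :=
        mul_le_mul_of_nonneg_left h h0
    _ = _ := by ring

end ChargeF

end

end Summit.QuantumFields.BalabanUV.T4Continuum.HistoryBankingFibreCharge
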